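import Summits.AnomalousDissipation.Statement
import Literature.Analysis.FluidPDE.TorusClassicalLerayHopf
import Summits.AnomalousDissipation.AnomalousDissipation.Theses.CoherentStates

/-!
# AnomalousDissipation / CoherentStates — assembly

Route `AnomalousDissipation/CoherentStates` (planner-AnomalousDissipation-Survey-0). Thesis X
(stmt-AnomalousDissipation-0218): a smooth steady divergence-free mean-zero force `f` and, for
viscosities `ν_j → 0`, time-periodic classical solutions of NS on `ℝ × T³` forced by `f` with
bounded mean energy and mean dissipation `≥ ε > 0`.

This file settles the two assembly items of the route:
* `coherent_assembly_fact` (stmt-AnomalousDissipation-0437): the named fact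
  `Literature.Analysis.FluidPDE.Torus.isGlobalLerayHopf_of_isClassicalNSSolutionOn` (global classical solution with smooth
  force, `ν > 0` ⇒ global Leray–Hopf from `u 0`; Galdi 2000 Thm 4.1) turns each `u_j` into a
  Leray–Hopf solution from `u_j 0`, and the remaining clauses of `AnomalousDissipation =
  Literature.Turb.ZerothLaw` are those of X verbatim;
* `coherent_assembly_bridged` (stmt-AnomalousDissipation-0406): the same with the fact's body
  inlined as the hypothesis (definitionally equal).
The only auxiliary step: a time-independent smooth field is jointly smooth in space–time
(`stLift (fun _ => f) = lift f ∘ Prod.snd`).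
-/

namespace AnomalousDissipation.CoherentStates

/-- A time-independent smooth field on `T³` is jointly smooth on `ℝ × T³`. [folklore] -/
theorem isSmoothSpaceTimeOn_const {f : UnitAddTorus (Fin 3) → EuclideanSpace ℝ (Fin 3)}
    (hf : Literature.Analysis.FunctionSpaces.Torus.IsSmooth f) : Literature.Analysis.FunctionSpaces.Torus.IsSmoothSpaceTimeOn Set.univ (fun _ : ℝ => f) := by
  have h : Literature.Analysis.FunctionSpaces.Torus.stLift (fun _ : ℝ => f) = Literature.Analysis.FunctionSpaces.Torus.lift f ∘ Prod.snd := rfl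
  unfold Literature.Analysis.FunctionSpaces.Torus.IsSmoothSpaceTimeOn
  rw [h]
  exact (hf.comp contDiff_snd).contDiffOn

/-- Settles stmt-AnomalousDissipation-0406 (assembly of route CoherentStates, bridge inlined):
(classical global solutions with smooth force are Leray–Hopf) → thesis X → `AnomalousDissipation`.
[folklore] -/
theorem coherent_assembly_bridged :
    (∀ (ν : ℝ) (f u : ℝ → UnitAddTorus (Fin 3) → EuclideanSpace ℝ (Fin 3)) (p : ℝ → UnitAddTorus (Fin 3) → ℝ), 0 < ν → Literature.Analysis.FunctionSpaces.Torus.IsClassicalNSSolutionOn Set.univ ν f u p → Literature.Analysis.FunctionSpaces.Torus.IsSmoothSpaceTimeOn Set.univ f → Literature.Analysis.FluidPDE.Torus.IsGlobalLerayHopf ν f (u 0) u) → (∃ f : UnitAddTorus (Fin 3) → EuclideanSpace ℝ (Fin 3), Literature.Analysis.FunctionSpaces.Torus.IsSmooth f ∧ Literature.Analysis.FunctionSpaces.Torus.IsDivFree f ∧ Literature.Analysis.FunctionSpaces.Torus.HasZeroMean f ∧ ∃ (ν τ : ℕ → ℝ) (u : ℕ → ℝ → UnitAddTorus (Fin 3)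 → EuclideanSpace ℝ (Fin 3)) (p : ℕ → ℝ → UnitAddTorus (Fin 3) → ℝ), (∀ j, 0 < ν j) ∧ Filter.Tendsto ν Filter.atTop (nhds 0) ∧ (∀ j, Literature.Analysis.FunctionSpaces.Torus.IsClassicalNSSolutionOn Set.univ (ν j) (fun _ => f) (u j) (p j) ∧ 0 < τ j ∧ Function.Periodic (u j) (τ j)) ∧ (∃ E : ℝ, ∀ j, Literature.Analysis.FluidPDE.meanEnergy (u j) ≤ E) ∧ ∃ ε : ℝ, 0 < ε ∧ ∀ j, ε ≤ Literature.Analysis.FluidPDE.meanDissipation (ν j) (u j)) → AnomalousDissipation := by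
  intro h hX
  obtain ⟨f, hf, hdiv, hmean, ν, τ, u, p, hν, hν0, hsol, hE, hε⟩ := hX
  exact ⟨f, hf, hdiv, hmean, ν, fun j => u j 0, u, hν, hν0,
    fun j => h (ν j) (fun _ => f) (u j) (p j) (hν j) (hsol j).1 (isSmoothSpaceTimeOn_const hf),
    hE, hε⟩

/-- Settles stmt-AnomalousDissipation-0437 (assembly of route CoherentStates, canonical shape):
`Literature.Analysis.FluidPDE.Torus.isGlobalLerayHopf_of_isClassicalNSSolutionOn` → thesis X → `AnomalousDissipation`.
[folklore] -/
theorem coherent_assembly_fact :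
    Literature.Analysis.FluidPDE.Torus.isGlobalLerayHopf_of_isClassicalNSSolutionOn → (∃ f : UnitAddTorus (Fin 3) → EuclideanSpace ℝ (Fin 3), Literature.Analysis.FunctionSpaces.Torus.IsSmooth f ∧ Literature.Analysis.FunctionSpaces.Torus.IsDivFree f ∧ Literature.Analysis.FunctionSpaces.Torus.HasZeroMean f ∧ ∃ (ν τ : ℕ → ℝ) (u : ℕ → ℝ → UnitAddTorus (Fin 3) → EuclideanSpace ℝ (Fin 3)) (p : ℕ → ℝ → UnitAddTorus (Fin 3) → ℝ), (∀ j, 0 < ν j) ∧ Filter.Tendsto ν Filter.atTop (nhds 0) ∧ (∀ j, Literature.Analysis.FunctionSpaces.Torus.IsClassicalNSSolutionOn Set.univ (ν j) (fun _ => f) (u j) (p j) ∧ 0 < τ j ∧ Function.Periodic (u j) (τ j)) ∧ (∃ E : ℝ, ∀ j, Literature.Analysis.FluidPDE.meanEnergy (u j) ≤ E) ∧ ∃ ε : ℝ, 0 < ε ∧ ∀ j, ε ≤ Literature.Analysis.FluidPDE.meanDissipation (ν j) (u j)) → AnomalousDissipation :=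
  fun h => coherent_assembly_bridged h

end AnomalousDissipation.CoherentStates

/-! ## The canonical assembly item `Assembly` (stmt-AnomalousDissipation-0266)

Appended 2026-08-16. The route decl
`Summit.AnomalousDissipation.AnomalousDissipation.Theses.CoherentStates.Assembly :=
CoherentThesis → ClassicalGlobalIsGlobalLerayHopf → AnomalousDissipation`, proved with its type
LITERALLY the route decl (the two theorems above prove unfolded variants and close nothing by
themselves). Since rev 6 of the route the deciding theorem
`Summit.AnomalousDissipation.AnomalousDissipation.Theses.CoherentStates.closes : CoherentThesis →
AnomalousDissipation` is proved in the route file itself (each periodic classical solution `u j` is a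
global Leray–Hopf solution from `u j 0` by the discharged Literature fact
`Literature.Analysis.FluidPDE.Torus.isGlobalLerayHopf_of_isClassicalNSSolutionOn`, used through
`IsClassicalNSSolutionOn.isGlobalLerayHopf`; Robinson–Rodrigo–Sadowski 2016 Thm 6.5, Galdi 2000
Thm 4.1), so the assembly is one line: the bridge hypothesis `ClassicalGlobalIsGlobalLerayHopf`
(support item 0223, itself proved in `Theorems/CoherentStatesClassicalGlobalIsGlobalLerayHopf.lean`)
is not even needed. Unconditional; axioms ⊆ {propext, Classical.choice, Quot.sound}.
-/

-- `Summit.<Summit>.<Problem>` is the tree's mandated summit-side namespace (CONVENTIONS §2); for this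
-- single-conjunct summit the two coincide, so the duplicate is deliberate.
set_option linter.dupNamespace false

namespace Summit.AnomalousDissipation.AnomalousDissipation.Theorems

open Summit.AnomalousDissipation.AnomalousDissipation.Theses.CoherentStates

/-- Settles stmt-AnomalousDissipation-0266 (the canonical assembly item `Assembly` of route
CoherentStates): `CoherentThesis → ClassicalGlobalIsGlobalLerayHopf → AnomalousDissipation`.
One line from the route's proved deciding theorem `closes : CoherentThesis → AnomalousDissipation`
(the Leray–Hopf bridge is the discharged Literature fact
`Literature.Analysis.FluidPDE.Torus.isGlobalLerayHopf_of_isClassicalNSSolutionOn`, invoked inside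
`closes`; the second hypothesis is discarded). Unconditional. [folklore] -/
theorem coherentStatesAssembly_proof :
    Summit.AnomalousDissipation.AnomalousDissipation.Theses.CoherentStates.Assembly := by
  unfold Assembly
  intro hX _
  exact closes hX

end Summit.AnomalousDissipation.AnomalousDissipation.Theorems
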